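import Summits.ValiantsHypothesis.ValiantsHypothesis.Theorems.KPlusLogSqLawTropicalBSplitDefs

/-!
# Route `KPlusLogSqLaw`, crux `TropicalB` — the permutation fibre of an UNSIGNED dominant chain

HONEST FRAMING.  Helper toward the registered stubs `stub_tropThin` / `stub_tropFat` of
`Cruxes/TropicalB/Lines/birth.lean` (crux `Summit.ValiantsHypothesis.ValiantsHypothesis.Theses.KPlusLogSqLaw.TropicalB`,
ledger item `stmt-ValiantsHypothesis-19771`, route `KPlusLogSqLaw`; cell `pub-symmetroid`, seat `val-sym-trop-p3`,
2026-08-26).  The UNSIGNED form (hypothesis `Function.Injective p`, resp. consecutive-distinct terms, instead of sign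
alternation) of the permutation-fibre count that val-sym-trop-p2 (`…TropicalBSymmetry.card_filter_fst_eq_le`,
`chain_succ_le_mul_card_perms`) and val-sym-lift-p2 (`…TropicalPermutationChanges.succ_le_card_perms_mul`) proved for
SIGNED chains — the currency of val-sym-trop-p1's unsigned row `DesignRowD` and visited-state engine, where sector
recursions run.  Same argument (for a fixed permutation the class vectors strictly increase in the product order of
exponents, tree lemma `TropicalCensus.d_lt_of_dominant`); nothing here bounds `TropicalB`, and nothing bears on
`KPlusLogSqLaw`, `MatrixDescartes` or `VP ≠ VNP`.

* `card_fibre_le_of_injective` : an injective family of terms dominant at strictly increasing slopes carries at most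
  `m(K−1)+1` terms with any fixed permutation;
* `succ_le_mul_card_perms_of_injective` : `N + 1 ≤ (m(K−1)+1)·|F|` when all its permutations lie in `F`;
* `designRowD_of_dominant_perms` : a design ALL of whose dominant permutations (at any integer slope) lie in a set `F`
  has unsigned row bound `(m(K−1)+1)·|F| − 1` — the form sector theorems about «few dominant permutations» plug into.
[folklore]
-/

set_option linter.dupNamespace false
set_option autoImplicit false

namespace Summit.ValiantsHypothesis.ValiantsHypothesis.Theorems.KPlusLogSqLaw

open Summit.ValiantsHypothesis.ValiantsHypothesis.Theorems.MatrixDescartes.Negative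
open Summit.ValiantsHypothesis.ValiantsHypothesis.Theorems.LacunarySymmetroidMatrixDescartes
open Summit.ValiantsHypothesis.ValiantsHypothesis.Theorems.LacunarySymmetroidMatrixDescartes.TropicalCensus
open scoped BigOperators
open Finset

section FibreUnsigned

variable {m K : ℕ}

/-- **The permutation fibre of an injective dominant family has at most `m(K−1)+1` terms.**  (Unsigned form of
val-sym-trop-p2's `card_filter_fst_eq_le`: for a fixed permutation the terms dominant at increasing slopes have strictly
increasing `termRank ∈ [0, m(K−1)]`.) [folklore] -/
theorem card_fibre_le_of_injective (d : Fin K → ℕ) (v ε : Fin m → Fin m → Fin K → ℤ) (N : ℕ) (θ : Fin (N + 1) → ℤ)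
    (p : Fin (N + 1) → Equiv.Perm (Fin m) × (Fin m → Fin K)) (hθ : StrictMono θ)
    (hdom : ∀ k, IsDominant d v ε (θ k) (p k)) (hinj : Function.Injective p) (σ : Equiv.Perm (Fin m)) :
    (univ.filter fun k => (p k).1 = σ).card ≤ m * (K - 1) + 1 := by
  have hkey : ∀ a b : Fin (N + 1), a < b → (p a).1 = (p b).1 → termRank d (p a) < termRank d (p b) := by
    intro a b hab h1
    have hne : p a ≠ p b := fun h => (ne_of_lt hab) (hinj h)
    have h2 : (p a).2 ≠ (p b).2 := fun h => hne (Prod.ext h1 h)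
    obtain ⟨i, hi⟩ := Function.ne_iff.mp h2
    have hpa : p a = ((p a).1, (p a).2) := rfl
    have hpb : p b = ((p a).1, (p b).2) := by rw [h1]
    have hda : IsDominant d v ε (θ a) ((p a).1, (p a).2) := hpa ▸ hdom a
    have hdb : IsDominant d v ε (θ b) ((p a).1, (p b).2) := hpb ▸ hdom b
    have hmono : ∀ j, dRank d ((p a).2 j) ≤ dRank d ((p b).2 j) := by
      intro j
      by_cases hj : (p a).2 j = (p b).2 j
      · rw [hj]
      · exact (dRank_lt_of_lt d (d_lt_of_dominant d v ε (hθ hab) _ _ _ hda hdb j hj)).le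
    have hstrict : dRank d ((p a).2 i) < dRank d ((p b).2 i) :=
      dRank_lt_of_lt d (d_lt_of_dominant d v ε (hθ hab) _ _ _ hda hdb i hi)
    unfold termRank
    exact sum_lt_sum (fun j _ => hmono j) ⟨i, mem_univ _, hstrict⟩
  let S := univ.filter fun k => (p k).1 = σ
  let f : S → Fin (m * (K - 1) + 1) := fun k => ⟨termRank d (p k), Nat.lt_succ_of_le (termRank_le d (p k))⟩
  have hf : Function.Injective f := by
    rintro ⟨a, ha⟩ ⟨b, hb⟩ hfab
    have ha' : (p a).1 = σ := (mem_filter.mp ha).2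
    have hb' : (p b).1 = σ := (mem_filter.mp hb).2
    have h2 : termRank d (p a) = termRank d (p b) := by
      have := congrArg (fun q : Fin (m * (K - 1) + 1) => (q : ℕ)) hfab
      simpa [f] using this
    rcases lt_trichotomy a b with h | h | h
    · exact absurd h2 (ne_of_lt (hkey a b h (ha'.trans hb'.symm)))
    · exact Subtype.ext h
    · exact absurd h2.symm (ne_of_lt (hkey b a h (hb'.trans ha'.symm)))
  have hcard := Fintype.card_le_of_injective f hf
  rwa [Fintype.card_coe, Fintype.card_fin] at hcard

/-- **Injective dominant families factor through their permutations**: `N + 1 ≤ (m(K−1)+1)·|F|` whenever all the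
permutations lie in `F`. [folklore] -/
theorem succ_le_mul_card_perms_of_injective (d : Fin K → ℕ) (v ε : Fin m → Fin m → Fin K → ℤ) (N : ℕ)
    (θ : Fin (N + 1) → ℤ) (p : Fin (N + 1) → Equiv.Perm (Fin m) × (Fin m → Fin K)) (hθ : StrictMono θ)
    (hdom : ∀ k, IsDominant d v ε (θ k) (p k)) (hinj : Function.Injective p)
    (F : Finset (Equiv.Perm (Fin m))) (hF : ∀ k, (p k).1 ∈ F) :
    N + 1 ≤ (m * (K - 1) + 1) * F.card := by
  have hcard : (univ : Finset (Fin (N + 1))).card = ∑ σ ∈ F, (univ.filter fun k => (p k).1 = σ).card :=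
    card_eq_sum_card_fiberwise fun k _ => hF k
  rw [card_univ, Fintype.card_fin] at hcard
  calc N + 1 ≤ ∑ σ ∈ F, (univ.filter fun k => (p k).1 = σ).card := hcard.le
    _ ≤ ∑ _σ ∈ F, (m * (K - 1) + 1) :=
        sum_le_sum fun σ _ => card_fibre_le_of_injective d v ε N θ p hθ hdom hinj σ
    _ = (m * (K - 1) + 1) * F.card := by rw [sum_const, smul_eq_mul, mul_comm]

/-- **Few dominant permutations ⇒ small unsigned row.**  If every dominant term of a design (at any integer slope) has
its permutation in `F`, the design has `DesignRowD d v ε ((m(K−1)+1)·|F| − 1)` (val-sym-trop-p1's unsigned row: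
consecutive-distinct dominant chains, injective by `injective_of_chainD`). [folklore] -/
theorem designRowD_of_dominant_perms (d : Fin K → ℕ) (v ε : Fin m → Fin m → Fin K → ℤ)
    (F : Finset (Equiv.Perm (Fin m)))
    (hF : ∀ (θ : ℤ) (q : Equiv.Perm (Fin m) × (Fin m → Fin K)), IsDominant d v ε θ q → q.1 ∈ F) :
    DesignRowD d v ε ((m * (K - 1) + 1) * F.card - 1) := by
  intro N θ p hθ hdom hne
  have := succ_le_mul_card_perms_of_injective d v ε N θ p hθ hdom (injective_of_chainD d v ε θ p hθ hdom hne)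
    F (fun k => hF (θ k) (p k) (hdom k))
  omega

end FibreUnsigned

end Summit.ValiantsHypothesis.ValiantsHypothesis.Theorems.KPlusLogSqLaw
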